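import Summits.AtomisticToContinuum.Crystallization.Theorems.ChartedPlanarOrderStackedDichotomy

/-!
# ChartedPlanarOrder — the layering dichotomy in ONE scale (`stackedUniform`)

decomp-a2c lens-3 (generation 23/24; N = `Theses.ChartedPlanarOrder.ChartedZeroExcessLayered`, PS column).

Corollary of `…StackedDichotomy.stackedDichotomy` in the form the `W_far` / `W_near` consumers want: the layer type is GLOBAL
(triangular and square windows are exclusive because `⟪a,b⟫` is a global datum and all per-layer scales `a′` lie in
`[16‖a‖/17, 16‖a‖/15]`), the planar Gram determinant is `≥ 24704/83521·s⁴` (coarea `≥ 0.5439 s²`), and the spacing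
windows are expressed in the single scale `s = ‖a‖ ≥ 27/32`:
(T) `95/289·s² ≤ |⟪a,b⟫|` and `192/425·s ≤ H_{m+1} ≤ 404/375·s` for every `m`, or
(S) `|⟪a,b⟫| ≤ 11/75·s²` and `8/17·s ≤ H_{m+1} ≤ 24/25·s` for every `m`.
-/

open MeasureTheory Set Metric
open scoped RealInnerProductSpace
open Summit.AtomisticToContinuum.Crystallization.Theorems.ChartedPlanarOrderRigidityDoor (E3)
open Summit.AtomisticToContinuum.Crystallization.Theorems.ChartedPlanarOrderDensityDichotomy (IsSep μS)
open Summit.AtomisticToContinuum.Crystallization.Theorems.ChartedPlanarOrderProfileSlavingLJ (IsStacked)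
open Summit.AtomisticToContinuum.Crystallization.Theorems.ChartedPlanarOrderDoorLayered (Layered)
open Summit.AtomisticToContinuum.Crystallization.Theorems.ChartedPlanarOrderCleanScaleP (IsCleanP)
open Summit.AtomisticToContinuum.Crystallization.Theorems.ChartedPlanarOrderStackedLayerGeometry (gram_lower_T gram_lower_S)
open Summit.AtomisticToContinuum.Crystallization.Theorems.ChartedPlanarOrderStackedDichotomy

namespace Summit.AtomisticToContinuum.Crystallization.Theorems.ChartedPlanarOrderStackedUniform

/-! ## §1 Scale conversion numerics -/

/-- a length `s` within `a′/16` of a pattern scale `a′ ≥ 9/10` pins the scale: `16s/17 ≤ a′ ≤ 16s/15`, and `s ≥ 27/32`. -/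
theorem scale_window {s a' : ℝ} (ha' : 9 / 10 ≤ a') (h : |s - a'| ≤ 1 / 16 * a') :
    16 / 17 * s ≤ a' ∧ a' ≤ 16 / 15 * s ∧ 27 / 32 ≤ s := by
  obtain ⟨h1, h2⟩ := abs_le.1 h
  exact ⟨by linarith, by linarith, by linarith⟩

/-- triangular type in the scale `s`: `95/289·s² ≤ |⟪a,b⟫|`. -/
theorem inner_lower_T {I s a' : ℝ} (hI : |(|I| - a' ^ 2 / 2)| ≤ 33 / 256 * a' ^ 2) (hlo : 16 / 17 * s ≤ a') (hs : 0 ≤ s) :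
    95 / 289 * s ^ 2 ≤ |I| := by
  have h1 := (abs_le.1 hI).1
  have h2 : 256 / 289 * s ^ 2 ≤ a' ^ 2 := by nlinarith [hlo, hs]
  linarith

/-- square type in the scale `s`: `|⟪a,b⟫| ≤ 11/75·s²`. -/
theorem inner_upper_S {I s a' : ℝ} (hI : |I| ≤ 33 / 256 * a' ^ 2) (hhi : a' ≤ 16 / 15 * s) (ha' : 0 ≤ a') :
    |I| ≤ 11 / 75 * s ^ 2 := by
  have h2 : a' ^ 2 ≤ 256 / 225 * s ^ 2 := by nlinarith [hhi, ha']
  linarith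

/-- the two types are EXCLUSIVE. -/
theorem not_T_and_S {I s : ℝ} (hT : 95 / 289 * s ^ 2 ≤ |I|) (hS : |I| ≤ 11 / 75 * s ^ 2) (hs : 27 / 32 ≤ s) : False := by
  nlinarith [hT, hS, hs]

/-- triangular spacing window in the scale `s`. -/
theorem window_T {H s a' : ℝ} (hlo : 16 / 17 * s ≤ a') (hhi : a' ≤ 16 / 15 * s)
    (h : 12 / 25 * a' ≤ H ∧ H ≤ 101 / 100 * a') : 192 / 425 * s ≤ H ∧ H ≤ 404 / 375 * s :=
  ⟨by linarith [h.1], by linarith [h.2]⟩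

/-- square spacing window in the scale `s`. -/
theorem window_S {H s a' : ℝ} (hlo : 16 / 17 * s ≤ a') (hhi : a' ≤ 16 / 15 * s)
    (h : 1 / 2 * a' ≤ H ∧ H ≤ 9 / 10 * a') : 8 / 17 * s ≤ H ∧ H ≤ 24 / 25 * s :=
  ⟨by linarith [h.1], by linarith [h.2]⟩

/-- the triangular clause in the `κ = ±1/2` form of `…StackedLayerGeometry.gram_lower_T`. -/
theorem exists_half_of_abs_abs {I a' r : ℝ} (h : |(|I| - a' ^ 2 / 2)| ≤ r) :
    ∃ κ : ℝ, (κ = 1 / 2 ∨ κ = -1 / 2) ∧ |I - a' ^ 2 * κ| ≤ r := by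
  rcases le_total 0 I with hI | hI
  · refine ⟨1 / 2, Or.inl rfl, ?_⟩
    rw [abs_of_nonneg hI] at h
    rwa [show I - a' ^ 2 * (1 / 2) = I - a' ^ 2 / 2 by ring]
  · refine ⟨-1 / 2, Or.inr rfl, ?_⟩
    rw [abs_of_nonpos hI] at h
    rwa [show I - a' ^ 2 * (-1 / 2) = -(-I - a' ^ 2 / 2) by ring, abs_neg]

/-- fourth powers in the scale `s`: `(16/17)⁴ s⁴ ≤ a′⁴`. -/
theorem pow_four_lower {s a' : ℝ} (hlo : 16 / 17 * s ≤ a') (hs : 0 ≤ s) : 65536 / 83521 * s ^ 4 ≤ a' ^ 4 := by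
  rw [show (65536 : ℝ) / 83521 * s ^ 4 = (16 / 17 * s) ^ 4 by ring]
  exact pow_le_pow_left₀ (by positivity) hlo 4

/-- ★ GRAM LOWER BOUND in the scale `s = ‖a‖` (both types): `24704/83521·‖a‖⁴ ≤ ‖a‖²‖b‖² − ⟪a,b⟫²`
(planar coarea `≥ 0.5439·‖a‖²`). -/
theorem gram_lower_uniform {a b : E3} {a' : ℝ} (ha'lo : 9 / 10 ≤ a') (ha : |‖a‖ - a'| ≤ 1 / 16 * a')
    (hb : |‖b‖ - a'| ≤ 1 / 16 * a')
    (htype : (|(|⟪a, b⟫| - a' ^ 2 / 2)| ≤ 33 / 256 * a' ^ 2) ∨ |⟪a, b⟫| ≤ 33 / 256 * a' ^ 2) :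
    24704 / 83521 * ‖a‖ ^ 4 ≤ ‖a‖ ^ 2 * ‖b‖ ^ 2 - ⟪a, b⟫ ^ 2 := by
  have ha'pos : 0 < a' := by linarith
  have h4 := pow_four_lower (scale_window ha'lo ha).1 (norm_nonneg a)
  rcases htype with hT | hS
  · obtain ⟨κ, hκ, hI⟩ := exists_half_of_abs_abs hT
    have := gram_lower_T ha'pos ha hb hκ hI
    linarith
  · have hI : |⟪a, b⟫ - a' ^ 2 * 0| ≤ 33 / 256 * a' ^ 2 := by simpa using hS
    have := gram_lower_S ha'pos ha hb hI
    have h0 : 0 ≤ ‖a‖ ^ 4 := by positivity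
    linarith

/-! ## §2 The uniform dichotomy -/

/-- ★★★ THE LAYERING DICHOTOMY IN ONE SCALE: for a separated, clean (`aHi ≤ 8/7`), stacked layered set with short periods,
`|‖b‖ − ‖a‖| ≤ ‖a‖/7`, the planar Gram determinant is `≥ 24704/83521·‖a‖⁴`, the layer type is global and the spacings
`H_{m+1} = ⟪ν, w (m+1) − w m⟫` satisfy, with `s = ‖a‖ ≥ 27/32`, either
(T) `95/289·s² ≤ |⟪a,b⟫|` and `192/425·s ≤ H_{m+1} ≤ 404/375·s` for all `m`, or
(S) `|⟪a,b⟫| ≤ 11/75·s²` and `8/17·s ≤ H_{m+1} ≤ 24/25·s` for all `m`. -/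
theorem stackedUniform {aHi : ℝ} (haHi : aHi ≤ 8 / 7) {δ : ℝ} (hδ : 0 < δ) {a b : E3} {w : ℤ → E3}
    (hsep : IsSep δ (Layered a b w)) (hclean : IsCleanP aHi (μS (Layered a b w))) (hst : IsStacked a b w)
    (han : ‖a‖ ≤ 17 / 16) (hbn : ‖b‖ ≤ 17 / 16) :
    ∃ ν : E3, ‖ν‖ = 1 ∧ ⟪ν, a⟫ = 0 ∧ ⟪ν, b⟫ = 0 ∧ (∀ m : ℤ, 0 < ⟪ν, w (m + 1) - w m⟫) ∧ 27 / 32 ≤ ‖a‖ ∧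
      |‖b‖ - ‖a‖| ≤ 1 / 7 * ‖a‖ ∧ 24704 / 83521 * ‖a‖ ^ 4 ≤ ‖a‖ ^ 2 * ‖b‖ ^ 2 - ⟪a, b⟫ ^ 2 ∧
      ((95 / 289 * ‖a‖ ^ 2 ≤ |⟪a, b⟫| ∧
          ∀ m : ℤ, 192 / 425 * ‖a‖ ≤ ⟪ν, w (m + 1) - w m⟫ ∧ ⟪ν, w (m + 1) - w m⟫ ≤ 404 / 375 * ‖a‖) ∨
       (|⟪a, b⟫| ≤ 11 / 75 * ‖a‖ ^ 2 ∧
          ∀ m : ℤ, 8 / 17 * ‖a‖ ≤ ⟪ν, w (m + 1) - w m⟫ ∧ ⟪ν, w (m + 1) - w m⟫ ≤ 24 / 25 * ‖a‖)) := by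
  obtain ⟨ν, hν1, hνa, hνb, hνpos, hlayer⟩ := stackedDichotomy haHi δ hδ a b w hsep hclean hst han hbn
  obtain ⟨a0, ha0lo, -, ha0, hb0, htype0⟩ := hlayer 0
  obtain ⟨hlo0, hhi0, hs⟩ := scale_window ha0lo ha0
  have hba : |‖b‖ - ‖a‖| ≤ 1 / 7 * ‖a‖ := by
    obtain ⟨h1, h2⟩ := abs_le.1 ha0
    obtain ⟨h3, h4⟩ := abs_le.1 hb0
    rw [abs_le]; constructor <;> linarith
  have hG : 24704 / 83521 * ‖a‖ ^ 4 ≤ ‖a‖ ^ 2 * ‖b‖ ^ 2 - ⟪a, b⟫ ^ 2 :=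
    gram_lower_uniform ha0lo ha0 hb0 (htype0.imp (fun h => h.1) (fun h => h.1))
  refine ⟨ν, hν1, hνa, hνb, hνpos, hs, hba, hG, ?_⟩
  -- per-layer data in the scale ‖a‖
  have key : ∀ m : ℤ,
      (95 / 289 * ‖a‖ ^ 2 ≤ |⟪a, b⟫| ∧
          192 / 425 * ‖a‖ ≤ ⟪ν, w (m + 1) - w m⟫ ∧ ⟪ν, w (m + 1) - w m⟫ ≤ 404 / 375 * ‖a‖) ∨
       (|⟪a, b⟫| ≤ 11 / 75 * ‖a‖ ^ 2 ∧
          8 / 17 * ‖a‖ ≤ ⟪ν, w (m + 1) - w m⟫ ∧ ⟪ν, w (m + 1) - w m⟫ ≤ 24 / 25 * ‖a‖) := by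
    intro m
    obtain ⟨am, hamlo, -, ham, -, htype⟩ := hlayer m
    obtain ⟨hlo, hhi, -⟩ := scale_window hamlo ham
    rcases htype with ⟨hI, hH1, hH2⟩ | ⟨hI, hH1, hH2⟩
    · exact Or.inl ⟨inner_lower_T hI hlo (norm_nonneg _), window_T hlo hhi ⟨hH1, hH2⟩⟩
    · exact Or.inr ⟨inner_upper_S hI hhi (by linarith), window_S hlo hhi ⟨hH1, hH2⟩⟩
  rcases key 0 with ⟨hT0, -⟩ | ⟨hS0, -⟩
  · left
    refine ⟨hT0, fun m => ?_⟩
    rcases key m with ⟨-, hw⟩ | ⟨hS, -⟩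
    · exact hw
    · exact (not_T_and_S hT0 hS hs).elim
  · right
    refine ⟨hS0, fun m => ?_⟩
    rcases key m with ⟨hT, -⟩ | ⟨-, hw⟩
    · exact (not_T_and_S hT hS0 hs).elim
    · exact hw

end Summit.AtomisticToContinuum.Crystallization.Theorems.ChartedPlanarOrderStackedUniform
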